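import Literature.NumberTheory.EllipticCurves.KummerMap
import Literature.NumberTheory.EllipticCurves.TorsionLocalKernelRestrictionProofs
import Literature.NumberTheory.EllipticCurves.SelmerInertiaProofs
import Literature.NumberTheory.EllipticCurves.NeronOggShafarevichLocal
import Literature.NumberTheory.EllipticCurves.GoodReductionUnramifiedProofs
import Literature.NumberTheory.EllipticCurves.HeegnerPointsKolyvaginLocalCriterion
import Literature.NumberTheory.EllipticCurves.GreenbergSelmer
import Literature.NumberTheory.EllipticCurves.GeomPointsGaloisModule
import Literature.NumberTheory.EllipticCurves.H1UnramifiedFinite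
import Literature.NumberTheory.EllipticCurves.GreenbergVatsal2000.ResidualSelmerGroups
import Summits.BirchSwinnertonDyer.BirchSwinnertonDyer.Theorems.PrintCFramBottomClassIndexLawFiveLeLevelDictionary
import HarnessLib

/-!
# Route `PrintCFram`, crux C2 `BottomClassIndexLawFiveLe` (stmt-BirchSwinnertonDyer-20372), line
# `eisenstein-resource-bdp-line` (LEAD g10, report §2(d)): **THE LEVEL DICTIONARY (α), KUMMER LAYER** — the
# Kummer cocycle of a rational point: non-vanishing, local triviality from LEVEL ≥ 1, unramifiedness, and the
# assembled dichotomy «an everywhere-unramified class for the quotient OR for the sub»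
# (cell `bsd-print-cfram`, width seat `bsd-line-cfram-p1-w4` g8; helper `--supports` 20372; 0 defs, 0 facts,
# 0 sorry)

HONEST FRAMING. Nothing about BSD is proved here, and nothing of any stub. Sequel of
`…LevelDictionary` ((α-core) `unramified_quot_or_sub_of_locally_trivial`). `K` a number field, `W/K` an
elliptic curve, `Γ = Γ_K`, `n = m ≠ 0`; the Kummer cocycle `z = (σ ↦ σQ − Q)` of `Q ∈ W(K̄)` with
`mQ = P ∈ W(K)` is the tree's `kummerCocycleTorsion W m Q _ : contOneCocycles (discreteTopRep Γ_K W[m])`.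

* §1 `kummerClassTorsion_ne_zero_of_forall_zsmul_ne` — `[z] ≠ 0` as soon as `P ∉ m·W(K)` (Galois descent
  `W(K̄)^Γ = W(K)`).
* §1 `kummerClassTorsion_mem_torsionLocalKer_of_baseChange_eq_zsmul` — **LEVEL ≥ 1 ⟹ locally trivial**: if
  `P = mR` in `W(E)` for a `K`-field `E` (a completion), then `[z] ∈ torsionLocalKer W E m`
  (`= ker (H¹(K, W[m]) → H¹(E, W[m]))`): on `Γ_E` the cocycle is the coboundary of the `m`-torsion point
  `ιQ − R`.
* §2 `coboundaryOn_decomp_of_mem_torsionLocalKer`, `coboundaryOn_inertia_of_mem_torsionLocalKer` — a class of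
  `torsionLocalKer W K_v m` is a coboundary on the decomposition group `GreenbergSelmer.decomp v` and on the
  inertia group `I_𝔓 ≤ Γ_K` of EVERY prime `𝔓` of `\bar ℤ_K` above `v` (all `m`-torsion is algebraic;
  `Γ_{K_v} → Γ_K` along an embedding cutting out `𝔓` reaches `I_𝔓`, Neukirch II (9.6)).
* §2 `kummerCocycleTorsion_apply_eq_zero_of_mem_inertia` — at a place `v ∤ m` of GOOD reduction the Kummer
  cocycle VANISHES on `I_𝔓` (Silverman VIII.1.5(b) / X.4.2(b), tree `smul_geomPoints_eq_of_mem_inertia`).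
* §2 `continuous_smul_geomTorsion` — the orbit maps of `W[m]` are continuous.
* §3 **`unramified_quot_or_sub_of_kummer`** — (α-W). `Φ ≤ W[m]` a `Γ_K`-stable subgroup
  (`GreenbergVatsal2000.StableSubgroup`; sub `Φ.Sub`, quotient `Φ.Quot`); ASSUME: `P ∉ m·W(K)`; at every finite
  place `v` that is NOT (good with `v ∤ m`): `[z] ∈ torsionLocalKer W K_v m` (at the place above `p` this is
  LEVEL ≥ 1 by §1; at a bad `ℓ ≠ p` with `W(K_ℓ)[m] = 0` it is automatic,
  `mem_torsionLocalKer_adicCompletion_of_forall_nsmul_eq_zero`) and `Φ.Quot` has no non-zero `I_𝔓`-invariant for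
  every `𝔓 ∣ v` (the quotient character is ramified there). THEN either the push-forward of `z` to `Φ.Quot`
  has non-zero class and is a coboundary on EVERY inertia group `I_𝔓` (all finite `𝔓`), or there is a
  continuous crossed homomorphism `w : Γ_K → Φ.Sub` with non-zero class, a coboundary on every `I_𝔓`, and
  `Φ.incl ∘ w = z − ∂m₁`. (LEAD g10 §2(d)(α): `K = ℚ`, `m = p`, `Φ` the rational line; feeding the two
  everywhere-unramified alternatives to the contrapositives of the ODD / EVEN engines gives
  «level ≥ 1 ⟹ the class factor `B_{1,ψ⁻¹}` is a non-unit».)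

THEOREMS ONLY; no definition, no named fact, no `sorry`. BSD is not proved by any of this; no summit statement
is proved by this seat. References: [SilvermanAEC2009] VIII.§2 (Kummer pairing), X.§4 (proof of Thm. 4.2(b),
Cor. 4.4), VII.4.1; [SerreGaloisCohomology1997] I.§5.1, II.§1.1; [NeukirchANT1999] II (9.6);
Greenberg, LNM 1716 (1999) §3; the LEAD g10 report §2(d).
-/

set_option autoImplicit false
-- `…BirchSwinnertonDyer.BirchSwinnertonDyer.Theorems…` is the problem's mandated namespace (D-0017).
set_option linter.dupNamespace false

noncomputable section

open scoped Classical Pointwise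

namespace Summit.BirchSwinnertonDyer.BirchSwinnertonDyer.Theorems.PrintCFram.LevelDictionary

open NumberField IsDedekindDomain Field WeierstrassCurve
open Literature.NumberTheory.EllipticCurves Literature.NumberTheory.GaloisRepresentations
  Literature.NumberTheory.EllipticCurves.GreenbergSelmer
  Literature.NumberTheory.EllipticCurves.GreenbergVatsal2000

universe u

variable {K : Type u} [Field K] [NumberField K] (W : WeierstrassCurve K)

/-! ## §1 The Kummer class of a rational point: non-vanishing, and local triviality from LEVEL ≥ 1 -/

/-- **`[σ ↦ σQ − Q] ≠ 0` when `P = mQ` is not `m`-divisible in `W(K)`.** If the Kummer class vanished,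
`Q − T` would be `Γ_K`-fixed for some `T ∈ W[m]`, hence rational (Galois descent,
`mem_range_toGeomPoints_iff`), `Q − T = R`, and `P = m(Q − T) = mR`. [cite: SilvermanAEC2009, VIII.§2 (Kummer sequence, exactness at `E(K)/mE(K)`)] -/
theorem kummerClassTorsion_ne_zero_of_forall_zsmul_ne {n : ℤ} (Q : geomPoints W)
    (hQfix : n • Q ∈ MulAction.fixedPoints (absoluteGaloisGroup K) (geomPoints W))
    (P : W.toAffine.Point) (hQ : n • Q = toGeomPoints W P) (hP : ∀ R : W.toAffine.Point, n • R ≠ P) :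
    kummerClassTorsion W n Q hQfix ≠ 0 := by
  intro h
  obtain ⟨T, hT, hfix⟩ := (kummerClassTorsion_eq_zero_iff W n Q hQfix).1 h
  obtain ⟨R, hR⟩ := (mem_range_toGeomPoints_iff W _).2 hfix
  apply hP R
  apply toGeomPoints_injective W
  rw [map_zsmul, hR, zsmul_sub, hQ, (mem_geomTorsion_iff W n T).1 hT, sub_zero]

omit [NumberField K] in
/-- **LEVEL ≥ 1 ⟹ locally trivial.** Let `mQ = P ∈ W(K)` and let `E` be a `K`-field (a completion `K_v`)
over which `P` becomes `m`-divisible: `P = mR` in `W(E)`. Then the Kummer class `[σ ↦ σQ − Q]` lies in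
`torsionLocalKer W E m = ker (H¹(K, W[m]) → H¹(E, W[m]))`: on `Γ_E` the cocycle is the coboundary of the
`m`-torsion point `ιQ − R ∈ W(K̄_E)[m]` (`R` is `Γ_E`-fixed). This is the reading «`n ≥ 1 ⟺ loc_p δ(g) = 0`»
of the LEAD g10 report §2(d). [cite: SilvermanAEC2009, VIII.§2 and X.§4 (the local Kummer sequence, diagram (**))] -/
theorem kummerClassTorsion_mem_torsionLocalKer_of_baseChange_eq_zsmul {n : ℤ} (Q : geomPoints W)
    (hQfix : n • Q ∈ MulAction.fixedPoints (absoluteGaloisGroup K) (geomPoints W))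
    (P : W.toAffine.Point) (hQ : n • Q = toGeomPoints W P)
    (E : Type u) [Field E] [Algebra K E] (R : (W.baseChange E).toAffine.Point)
    (hR : Affine.Point.baseChange (W' := W) K E P = n • R) :
    kummerClassTorsion W n Q hQfix ∈ W.torsionLocalKer E n := by
  -- the `E`-rational point `R` read in `W(K̄_E)`, fixed by `Γ_E`
  set R' : localPoints W E :=
    (Affine.Point.map (W' := W) (IsScalarTower.toAlgHom K E (AlgebraicClosure E)) R : localPoints W E)
    with hR'
  have hRfix : ∀ τ : absoluteGaloisGroup E, τ • R' = R' := fun τ ↦ by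
    rw [hR', localPoints.smul_def]
    change Affine.Point.map _ (Affine.Point.map _ R) = Affine.Point.map _ R
    rw [Affine.Point.map_map]
    refine congrArg (fun f ↦ Affine.Point.map (W' := W) f R) ?_
    ext x
    exact AlgEquiv.commutes (show AlgebraicClosure E ≃ₐ[E] AlgebraicClosure E from τ) x
  have hjP : (Affine.Point.map (W' := W) (IsScalarTower.toAlgHom K E (AlgebraicClosure E))
      (Affine.Point.baseChange (W' := W) K E P) : localPoints W E) = pointsMap W E (toGeomPoints W P) := by
    change Affine.Point.map _ (Affine.Point.baseChange (W' := W) K E P) =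
      Affine.Point.map (closureEmb (K := K) E) (Affine.Point.baseChange (W' := W) K (AlgebraicClosure K) P)
    rw [Affine.Point.map_baseChange, Affine.Point.map_baseChange]
  have hPn : pointsMap W E (toGeomPoints W P) = n • R' := by
    rw [← hjP, hR, map_zsmul, hR']
    rfl
  -- `X = ι Q − R'` is `n`-torsion
  have hX : n • (pointsMap W E Q - R') = 0 := by
    rw [zsmul_sub, ← map_zsmul, hQ, hPn, sub_self]
  change oneCocycleClass _ (kummerCocycleTorsion W n Q hQfix) ∈
    resKer (resGal (K := K) E) (torsionPointsMap W E n) (torsionPointsMap_smul W E n)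
  rw [oneCocycleClass_mem_resKer_iff]
  refine ⟨⟨pointsMap W E Q - R', (Submodule.mem_torsionBy_iff _ _).mpr hX⟩, fun x ↦ Subtype.ext ?_⟩
  rw [coe_torsionPointsMap, coe_kummerCocycleTorsion_apply, map_sub, pointsMap_smul,
    AddSubgroupClass.coe_sub, AddSubgroup.torsionBy.coe_smul]
  change _ = x • (pointsMap W E Q - R') - (pointsMap W E Q - R')
  rw [smul_sub, hRfix]
  abel

/-! ## §2 Local triviality in `H¹(K_v, W[m])` ⟹ coboundary on `D_v` and on every `I_𝔓`, `𝔓 ∣ v` -/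

variable [W.IsElliptic]

/-- **Local kernel ⟹ coboundary on the decomposition group.** A class of
`torsionLocalKer W K_v m = ker (H¹(K, W[m]) → H¹(K_v, W[m]))` (`m ≠ 0`), represented by the continuous
crossed homomorphism `φ`, is a coboundary on `D_v = GreenbergSelmer.decomp v` (the range of `Γ_{K_v} → Γ_K`):
the restricted cocycle is `∂a` for an `m`-torsion point `a` of `W(K̄_v)`, and every such point comes from
`W[m](K̄)` (`torsionPointsMap_bijective`). [cite: SerreGaloisCohomology1997, I.§5.1 and II.§1.1] [cite: SilvermanAEC2009, Cor. III.6.4(b)] -/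
theorem coboundaryOn_decomp_of_mem_torsionLocalKer {m : ℕ} (hm : m ≠ 0) (v : HeightOneSpectrum (𝓞 K))
    (φ : contOneCocycles (discreteTopRep (absoluteGaloisGroup K) (geomTorsion W (m : ℤ))))
    (hφ : oneCocycleClass _ φ ∈ W.torsionLocalKer (v.adicCompletion K) (m : ℤ)) :
    ∃ t : geomTorsion W (m : ℤ), ∀ g ∈ decomp v, φ.1 g = g • t - t := by
  haveI : CharZero (v.adicCompletion K) :=
    charZero_of_injective_algebraMap (algebraMap K (v.adicCompletion K)).injective
  obtain ⟨a, ha⟩ := (oneCocycleClass_mem_resKer_iff _ _ _ φ).1 hφ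
  obtain ⟨t, rfl⟩ := (torsionPointsMap_bijective W (v.adicCompletion K) hm).2 a
  refine ⟨t, fun g hg ↦ ?_⟩
  obtain ⟨σ, rfl⟩ := (mem_decomp_iff v g).1 hg
  have h := ha σ
  rw [← torsionPointsMap_smul, ← map_sub] at h
  have h' := torsionPointsMap_injective W (v.adicCompletion K) (m : ℤ) h
  rw [resGal_eq_absGaloisRestrict] at h'
  exact h'

/-- **Local kernel ⟹ coboundary on EVERY inertia group above `v`.** A class of `torsionLocalKer W K_v m`
(`m ≠ 0`), represented by `φ`, is a coboundary on the inertia group `I_𝔓 ≤ Γ_K` of every prime `𝔓` of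
`\bar ℤ_K` above `v`: `𝔓` is cut out by an embedding `ι : K̄ → K̄_v` (`Γ_K` is transitive on the primes above
`v`), the local kernel does not depend on the embedding (`torsionLocalKer_eq_resKer_of_emb`), the restricted
cocycle is `∂(ι t)` for some `t ∈ W[m](K̄)` (all `m`-torsion of `W(K̄_v)` is `ι`-algebraic), and every
`τ ∈ I_𝔓` lifts to `Γ_{K_v}` along `ι` (Neukirch II (9.6), tree `exists_mem_inertia_apply_eq_holds`).
[cite: NeukirchANT1999, Ch. II §9 Prop. (9.6)] [cite: SerreGaloisCohomology1997, II.§1.1] -/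
theorem coboundaryOn_inertia_of_mem_torsionLocalKer {m : ℕ} (hm : m ≠ 0) (v : HeightOneSpectrum (𝓞 K))
    (φ : contOneCocycles (discreteTopRep (absoluteGaloisGroup K) (geomTorsion W (m : ℤ))))
    (hφ : oneCocycleClass _ φ ∈ W.torsionLocalKer (v.adicCompletion K) (m : ℤ))
    {𝔓 : Ideal (absIntegers (𝓞 K) K)} (h𝔓 : 𝔓 ∈ v.primesAbove) :
    ∃ t : geomTorsion W (m : ℤ), ∀ τ ∈ 𝔓.inertia (absoluteGaloisGroup K), φ.1 τ = τ • t - t := by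
  obtain ⟨𝔐, h𝔐⟩ := v.localPrimesAbove_nonempty
  -- arrange `𝔓 = 𝔓_{ι,𝔐}` for an embedding `ι : K̄ → K̄_v`
  obtain ⟨g, hg⟩ := HeightOneSpectrum.exists_smul_eq_of_mem_primesAbove_holds
    (HeightOneSpectrum.primeBelow_mem_primesAbove
      (ι := closureEmb (K := K) (v.adicCompletion K)) h𝔐) h𝔓
  set ι : AlgebraicClosure K →ₐ[K] AlgebraicClosure (v.adicCompletion K) :=
    (closureEmb (K := K) (v.adicCompletion K)).comp
      ((show AlgebraicClosure K ≃ₐ[K] AlgebraicClosure K from g⁻¹) :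
        AlgebraicClosure K →ₐ[K] AlgebraicClosure K) with hι
  have h1 : 𝔓 = v.primeBelow ι 𝔐 := by
    rw [hι, HeightOneSpectrum.primeBelow_comp, ← hg]
    exact congrArg (· • _) (inv_inv g).symm
  -- the torsion points map along `ι`
  let ψ : geomTorsion W (m : ℤ) →+ AddSubgroup.torsionBy (localPoints W (v.adicCompletion K)) (m : ℤ) :=
    ((pointsMapOfEmb W ι).comp (geomTorsion W (m : ℤ)).subtype).codRestrict _ fun T ↦
      (Submodule.mem_torsionBy_iff _ _).mpr (by
        simp only [AddMonoidHom.coe_comp, AddSubgroup.coe_subtype, Function.comp_apply]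
        rw [← map_zsmul, (mem_geomTorsion_iff W (m : ℤ) _).mp T.2, map_zero])
  have hψ : ∀ T : geomTorsion W (m : ℤ), (ψ T : localPoints W (v.adicCompletion K)) = pointsMapOfEmb W ι T :=
    fun T ↦ rfl
  have hψsmul : ∀ (x : absoluteGaloisGroup (v.adicCompletion K)) (T : geomTorsion W (m : ℤ)),
      ψ (resGalOfEmb ι x • T) = x • ψ T := fun x T ↦ Subtype.ext (by
    rw [hψ, AddSubgroup.torsionBy.coe_smul, AddSubgroup.torsionBy.coe_smul, hψ]
    exact pointsMapOfEmb_smul W ι x T)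
  have hker : resKer (resGalOfEmb ι) ψ hψsmul = W.torsionLocalKer (v.adicCompletion K) (m : ℤ) :=
    torsionLocalKer_eq_resKer_of_emb W ι (m : ℤ) ψ hψ hψsmul
  rw [← hker, oneCocycleClass_mem_resKer_iff] at hφ
  obtain ⟨a, ha⟩ := hφ
  -- `a = ι t₀`: all `m`-torsion of `W(K̄_v)` is `ι`-algebraic
  have ham : m • (a : localPoints W (v.adicCompletion K)) = 0 := by
    rw [← natCast_zsmul]
    exact (Submodule.mem_torsionBy_iff _ _).mp a.2
  obtain ⟨t₀, ht₀, hta⟩ := exists_pointsMapOfEmb_eq_of_nsmul_eq_zero W ι hm ham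
  let t : geomTorsion W (m : ℤ) :=
    ⟨t₀, (mem_geomTorsion_iff W (m : ℤ) t₀).mpr (by rw [natCast_zsmul]; exact ht₀)⟩
  refine ⟨t, fun τ hτ ↦ ?_⟩
  rw [h1] at hτ
  obtain ⟨σ, -, hσ⟩ := IsDedekindDomain.HeightOneSpectrum.exists_mem_inertia_apply_eq_holds v ι h𝔐 hτ
  have hres : resGalOfEmb ι σ = τ := resGalOfEmb_eq_of_apply_eq ι hσ
  have h := congrArg Subtype.val (ha σ)
  rw [hψ, hres, AddSubgroupClass.coe_sub, AddSubgroup.torsionBy.coe_smul, ← hta] at h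
  -- `h : ι (φ τ) = σ • ι t₀ − ι t₀ = ι (τ • t₀ − t₀)`
  rw [← pointsMapOfEmb_smul W ι σ t₀, hres, ← map_sub] at h
  apply Subtype.ext
  rw [AddSubgroupClass.coe_sub, AddSubgroup.torsionBy.coe_smul]
  exact pointsMapOfEmb_injective W ι h

/-- **At a place of good reduction `v ∤ n` the Kummer cocycle vanishes on `I_𝔓`** (`𝔓 ∣ v`): for
`τ ∈ I_𝔓`, `n(τQ − Q) = τP − P = O`, so `τQ = Q` (tree `smul_geomPoints_eq_of_mem_inertia`: inertia acts
trivially on the reduction and `W[n] ↪ W̃`). [cite: SilvermanAEC2009, Prop. VIII.1.5(b) (proof) and X.§4 proof of Thm. 4.2(b)] -/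
theorem kummerCocycleTorsion_apply_eq_zero_of_mem_inertia {n : ℤ} (Q : geomPoints W)
    (hQfix : n • Q ∈ MulAction.fixedPoints (absoluteGaloisGroup K) (geomPoints W))
    {v : HeightOneSpectrum (𝓞 K)} (hv : W.HasGoodReductionAt v) (hn : (n : 𝓞 K) ∉ v.asIdeal)
    {𝔓 : Ideal (absIntegers (𝓞 K) K)} (h𝔓 : 𝔓 ∈ v.primesAbove)
    {τ : absoluteGaloisGroup K} (hτ : τ ∈ 𝔓.inertia (absoluteGaloisGroup K)) :
    (kummerCocycleTorsion W n Q hQfix).1 τ = 0 := by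
  apply Subtype.ext
  rw [coe_kummerCocycleTorsion_apply, ZeroMemClass.coe_zero, sub_eq_zero]
  exact W.smul_geomPoints_eq_of_mem_inertia hv hn h𝔓 hτ
    ((mem_geomTorsion_iff W n _).mp ((kummerCocycleTorsion W n Q hQfix).1 τ).2)

omit [NumberField K] [W.IsElliptic] in
/-- The orbit maps `g ↦ g • t` of the discrete `Γ_K`-module `W[n]` are continuous (those of `W(K̄)` are,
`continuous_smul_geomPoints`). [folklore] -/
theorem continuous_smul_geomTorsion (n : ℤ) (t : geomTorsion W n) :
    Continuous fun g : absoluteGaloisGroup K ↦ g • t := by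
  rw [continuous_discrete_rng]
  intro s
  have hset : (fun g : absoluteGaloisGroup K ↦ g • t) ⁻¹' {s} =
      (fun g : absoluteGaloisGroup K ↦ g • (t : geomPoints W)) ⁻¹' {(s : geomPoints W)} := by
    ext g
    simp only [Set.mem_preimage, Set.mem_singleton_iff]
    rw [← AddSubgroup.torsionBy.coe_smul]
    exact ⟨fun h ↦ congrArg Subtype.val h, fun h ↦ Subtype.ext h⟩
  rw [hset]
  exact (isOpen_discrete _).preimage (continuous_smul_geomPoints W (t : geomPoints W))

/-! ## §3 (α-W): an everywhere-unramified class for the quotient or for the sub -/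

/-- **(α-W) THE LEVEL DICTIONARY, KUMMER LAYER.** `K` a number field, `W/K` elliptic, `m ≠ 0`,
`Φ ≤ W[m]` a `Γ_K`-stable subgroup with sub `Φ.Sub` and quotient `Φ.Quot`; `Q ∈ W(K̄)` with
`mQ = P ∈ W(K)` NOT `m`-divisible in `W(K)`; `z = (σ ↦ σQ − Q)` its Kummer cocycle. ASSUME, at every finite
place `v` which is not a place of good reduction prime to `m`: (i) `[z] ∈ torsionLocalKer W K_v m` (at the
place above `p` this is LEVEL ≥ 1, `kummerClassTorsion_mem_torsionLocalKer_of_baseChange_eq_zsmul`; at a bad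
`ℓ ∤ m` with `W(K_ℓ)[m] = 0` it is automatic, `mem_torsionLocalKer_adicCompletion_of_forall_nsmul_eq_zero`);
(ii) `Φ.Quot` has no non-zero invariant under `I_𝔓` for every `𝔓 ∣ v` (the quotient character is ramified at
`v`). THEN: EITHER the push-forward of `z` to `Φ.Quot` has NON-ZERO class in `H¹(K, Φ.Quot)` and is a
coboundary on the inertia group `I_𝔓` of EVERY prime `𝔓` of `\bar ℤ_K` (unramified everywhere), OR there are
a continuous crossed homomorphism `w : Γ_K → Φ.Sub` with NON-ZERO class in `H¹(K, Φ.Sub)`, a coboundary on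
every `I_𝔓`, and `m₁ ∈ W[m]` with `Φ.incl (w g) = z g − (g m₁ − m₁)`. At the good places prime to `m`
nothing is assumed: `z` vanishes on `I_𝔓` and `I_𝔓` acts trivially on `W[m]`
(`kummerCocycleTorsion_apply_eq_zero_of_mem_inertia`, `smul_geomTorsion_eq_of_mem_inertia`); the rest is
(α-core) `unramified_quot_or_sub_of_locally_trivial` with `𝓘 = {I_𝔓}`. (LEAD g10 report §2(d)(α), `K = ℚ`,
`Φ = W[𝔭]` the rational line.) [cite: SilvermanAEC2009, X.§4 (proof of Thm. 4.2(b)) and VIII.§2]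
[cite: GreenbergLNM1716, §3 (PDF p. 86)] -/
theorem unramified_quot_or_sub_of_kummer {m : ℕ} (hm : m ≠ 0)
    (Φ : StableSubgroup (absoluteGaloisGroup K) (geomTorsion W (m : ℤ)))
    (Q : geomPoints W)
    (hQfix : (m : ℤ) • Q ∈ MulAction.fixedPoints (absoluteGaloisGroup K) (geomPoints W))
    (P : W.toAffine.Point) (hQ : (m : ℤ) • Q = toGeomPoints W P)
    (hP : ∀ R : W.toAffine.Point, (m : ℤ) • R ≠ P)
    (hloc : ∀ v : HeightOneSpectrum (𝓞 K), ¬ (W.HasGoodReductionAt v ∧ ((m : ℕ) : 𝓞 K) ∉ v.asIdeal) →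
      kummerClassTorsion W (m : ℤ) Q hQfix ∈ W.torsionLocalKer (v.adicCompletion K) (m : ℤ))
    (hQI : ∀ v : HeightOneSpectrum (𝓞 K), ¬ (W.HasGoodReductionAt v ∧ ((m : ℕ) : 𝓞 K) ∉ v.asIdeal) →
      ∀ 𝔓 ∈ v.primesAbove, ∀ q : Φ.Quot,
        (∀ g ∈ 𝔓.inertia (absoluteGaloisGroup K), g • q = q) → q = 0) :
    (∃ zq : contOneCocycles (discreteTopRep (absoluteGaloisGroup K) Φ.Quot),
      (∀ g, zq.1 g = Φ.proj ((kummerCocycleTorsion W (m : ℤ) Q hQfix).1 g)) ∧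
      oneCocycleClass _ zq ≠ 0 ∧
      ∀ (v : HeightOneSpectrum (𝓞 K)) (𝔓 : Ideal (absIntegers (𝓞 K) K)), 𝔓 ∈ v.primesAbove →
        ∃ q : Φ.Quot, ∀ g ∈ 𝔓.inertia (absoluteGaloisGroup K), zq.1 g = g • q - q) ∨
    (∃ (w : contOneCocycles (discreteTopRep (absoluteGaloisGroup K) Φ.Sub)) (m₁ : geomTorsion W (m : ℤ)),
      oneCocycleClass _ w ≠ 0 ∧
      (∀ (v : HeightOneSpectrum (𝓞 K)) (𝔓 : Ideal (absIntegers (𝓞 K) K)), 𝔓 ∈ v.primesAbove →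
        ∃ s : Φ.Sub, ∀ g ∈ 𝔓.inertia (absoluteGaloisGroup K), w.1 g = g • s - s) ∧
      ∀ g, Φ.incl (w.1 g) = (kummerCocycleTorsion W (m : ℤ) Q hQfix).1 g - (g • m₁ - m₁)) := by
  set z := kummerCocycleTorsion W (m : ℤ) Q hQfix with hz
  -- the family of inertia groups of all primes of `\bar ℤ_K`
  set 𝓘 : Set (Subgroup (absoluteGaloisGroup K)) :=
    {I | ∃ (v : HeightOneSpectrum (𝓞 K)) (𝔓 : Ideal (absIntegers (𝓞 K) K)),
      𝔓 ∈ v.primesAbove ∧ I = 𝔓.inertia (absoluteGaloisGroup K)} with h𝓘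
  have hmem : ∀ (v : HeightOneSpectrum (𝓞 K)) (𝔓 : Ideal (absIntegers (𝓞 K) K)), 𝔓 ∈ v.primesAbove →
      𝔓.inertia (absoluteGaloisGroup K) ∈ 𝓘 := fun v 𝔓 h𝔓 ↦ ⟨v, 𝔓, h𝔓, rfl⟩
  -- the data of (α-core)
  have hι : ∀ (g : absoluteGaloisGroup K) (s : Φ.Sub), Φ.incl (g • s) = g • Φ.incl s := fun _ _ ↦ rfl
  have hπ : ∀ (g : absoluteGaloisGroup K) (x : geomTorsion W (m : ℤ)), Φ.proj (g • x) = g • Φ.proj x :=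
    fun _ _ ↦ rfl
  have hιinj : Function.Injective Φ.incl := fun a b h ↦ Subtype.ext h
  have hπsurj : Function.Surjective Φ.proj := QuotientAddGroup.mk'_surjective _
  have hπι : ∀ s : Φ.Sub, Φ.proj (Φ.incl s) = 0 := fun s ↦
    (QuotientAddGroup.eq_zero_iff _).mpr s.2
  have hker : ∀ x : geomTorsion W (m : ℤ), Φ.proj x = 0 → ∃ s : Φ.Sub, Φ.incl s = x := fun x hx ↦
    ⟨⟨x, (QuotientAddGroup.eq_zero_iff x).mp hx⟩, rfl⟩
  have hQ𝓘 : ∀ I ∈ 𝓘, (∀ q : Φ.Quot, (∀ g ∈ I, g • q = q) → q = 0) ∨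
      (∀ g ∈ I, ∀ x : geomTorsion W (m : ℤ), g • x = x) := by
    rintro I ⟨v, 𝔓, h𝔓, rfl⟩
    by_cases hgood : W.HasGoodReductionAt v ∧ ((m : ℕ) : 𝓞 K) ∉ v.asIdeal
    · exact Or.inr fun g hg x ↦ W.smul_geomTorsion_eq_of_mem_inertia hgood.1
        (n := (m : ℤ)) (by exact_mod_cast hgood.2) h𝔓 hg x
    · exact Or.inl (hQI v hgood 𝔓 h𝔓)
  have hzne : oneCocycleClass _ z ≠ 0 :=
    kummerClassTorsion_ne_zero_of_forall_zsmul_ne W Q hQfix P hQ hP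
  have hzloc : ∀ I ∈ 𝓘, ∃ x : geomTorsion W (m : ℤ), ∀ g ∈ I, z.1 g = g • x - x := by
    rintro I ⟨v, 𝔓, h𝔓, rfl⟩
    by_cases hgood : W.HasGoodReductionAt v ∧ ((m : ℕ) : 𝓞 K) ∉ v.asIdeal
    · refine ⟨0, fun g hg ↦ ?_⟩
      rw [smul_zero, sub_zero]
      exact kummerCocycleTorsion_apply_eq_zero_of_mem_inertia W Q hQfix hgood.1
        (n := (m : ℤ)) (by exact_mod_cast hgood.2) h𝔓 hg
    · exact coboundaryOn_inertia_of_mem_torsionLocalKer W hm v z (hloc v hgood) h𝔓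
  -- (α-core)
  rcases unramified_quot_or_sub_of_locally_trivial (continuous_smul_geomTorsion W (m : ℤ)) Φ.incl Φ.proj
      hι hπ hιinj hπsurj hπι hker 𝓘 hQ𝓘 z hzne hzloc with ⟨hq, hqloc⟩ | ⟨w, m₁, hw, hwloc, hwz⟩
  · refine Or.inl ⟨contOneCocycles.pullback (ContinuousMonoidHom.id _)
      (resHomOfEquivariant (ContinuousMonoidHom.id _) Φ.proj hπ) z, fun g ↦ rfl, hq, fun v 𝔓 h𝔓 ↦ ?_⟩
    exact hqloc _ (hmem v 𝔓 h𝔓)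
  · exact Or.inr ⟨w, m₁, hw, fun v 𝔓 h𝔓 ↦ hwloc _ (hmem v 𝔓 h𝔓), hwz⟩

end Summit.BirchSwinnertonDyer.BirchSwinnertonDyer.Theorems.PrintCFram.LevelDictionary

end
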